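import Literature.AnabelianGeometry.SemiGraphs.TemperoidsHomProofs
import Literature.AnabelianGeometry.SemiGraphs.TemperoidsResProofs

/-!
# [SemiAnbd] Proposition 3.2 ("Grothendieck conjecture for connected temperoids"): the equivalence

Mochizuki, *Semi-graphs of anabelioids*, Publ. RIMS **42** (2006), §3, Proposition 3.2 p. 35
[cite: MochizukiSemiAnbd2006, Prop 3.2 p.35]: "the category of morphisms `T₁ → T₂` is equivalent to
the category whose objects are continuous group homomorphisms `φ : Π₁ → Π₂` and whose morphisms
`φ → ψ` are elements `g ∈ Π₂` such that `γ_g ∘ φ = ψ`".  ASSEMBLY of the named fact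
`GCConnectedTemperoids` of `Temperoids.lean` from the landed pieces:

* the functor `φ ↦ B^temp(φ)` lands in morphisms of temperoids (`ResIsTemperoidHom_holds`,
  abc-iut-L3-d2), and `g ↦` "act by `g`" (`BTemp.resIsoOfConj`, abc-iut-L3-t10) makes it a functor
  `ContHomCat Π₁ Π₂ ⥤ TemperoidHomCat (B^temp Π₁) (B^temp Π₂)` (built inside the proof);
* it is FULL (`BTemp.exists_conj_of_natTrans`: every natural transformation is the action of some
  `g` with `γ_g ∘ φ = ψ`) and FAITHFUL (an element acting trivially on every `Π₂/N` is `1`, the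
  "separated" clause of temperedness);
* it is essentially surjective exactly when every morphism of temperoids is `≅ B^temp(φ)` — the
  surjectivity half `TemperoidHomEqRes` (abc-iut-L3-d2, `TemperoidsHomEqResProofs`).

Hence `GCConnectedTemperoids_of : TemperoidHomEqRes Π₁ Π₂ → GCConnectedTemperoids Π₁ Π₂`; the
unconditional `GCConnectedTemperoids_holds` is the two-line composition with
`TemperoidHomEqRes_holds` (filed separately once that file is in the tree).  Proof-only file.
-/

noncomputable section

namespace Literature.AnabelianGeometry.SemiGraphs

open CategoryTheory Topology

universe u

namespace BTemp

variable {G₂ : Type u} [Group G₂] [TopologicalSpace G₂] (hG : IsTempered G₂)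

include hG in
/-- An element of a tempered group lying in every open normal subgroup is trivial — the "separated"
clause of Definition 3.1 (i). [cite: MochizukiSemiAnbd2006, Def 3.1(i) p.33] -/
theorem eq_one_of_forall_mem_openNormal (g : G₂) (h : ∀ N : OpenNormalSubgroup G₂, g ∈ N) :
    g = 1 := by
  by_contra hg1
  obtain ⟨N, hN⟩ := hG.separated g hg1
  exact hN (h N)

end BTemp

/-! ### Proposition 3.2: the equivalence, modulo the surjectivity half -/

/-- **[SemiAnbd] Proposition 3.2** — the equivalence `TemperoidHomCat (B^temp Π₁) (B^temp Π₂) ≌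
ContHomCat Π₁ Π₂`, REDUCED to the surjectivity half `TemperoidHomEqRes` (every morphism of temperoids
is `≅ B^temp(φ)`): the comparison functor `φ ↦ B^temp(φ)`, `g ↦` "act by `g`"
(`BTemp.resIsoOfConj`) is full (`BTemp.exists_conj_of_natTrans`), faithful (separatedness of `Π₂`)
and essentially surjective by that hypothesis. [cite: MochizukiSemiAnbd2006, Prop 3.2 p.35] -/
theorem GCConnectedTemperoids_of (G₁ : Type u) [Group G₁] [TopologicalSpace G₁] (G₂ : Type u)
    [Group G₂] [TopologicalSpace G₂] (h : TemperoidHomEqRes G₁ G₂) :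
    GCConnectedTemperoids G₁ G₂ := by
  intro _ _ _ _ hG₁ hG₂
  -- the comparison functor
  let E : ContHomCat G₁ G₂ ⥤ TemperoidHomCat (BTemp G₁) (BTemp G₂) :=
    { obj := fun φ => ⟨BTemp.res φ.hom, ResIsTemperoidHom_holds G₁ G₂ hG₁ hG₂ φ.hom⟩
      map := fun {φ ψ} f =>
        ObjectProperty.homMk (BTemp.resIsoOfConj φ.hom ψ.hom f.elt f.conj_eq).hom
      map_id := fun φ => by
        apply ObjectProperty.hom_ext
        apply NatTrans.ext
        funext X
        apply ObjectProperty.hom_ext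
        apply Action.Hom.ext
        refine ConcreteCategory.hom_ext _ _ fun x => ?_
        change X.obj.ρ 1 x = x
        rw [map_one]
        rfl
      map_comp := fun {φ ψ χ} f g => by
        apply ObjectProperty.hom_ext
        apply NatTrans.ext
        funext X
        apply ObjectProperty.hom_ext
        apply Action.Hom.ext
        refine ConcreteCategory.hom_ext _ _ fun x => ?_
        change X.obj.ρ (g.elt * f.elt) x = X.obj.ρ g.elt (X.obj.ρ f.elt x)
        rw [map_mul]
        rfl }
  have hmap : ∀ {φ ψ : ContHomCat G₁ G₂} (f : φ ⟶ ψ) (X : BTemp G₂) (x : X.obj.V),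
      ((E.map f).hom.app X).hom.hom x = X.obj.ρ f.elt x := fun f X x => rfl
  -- full: every natural transformation is "act by g" (Yoneda on the `Π₂/N`)
  haveI : E.Full := by
    refine ⟨fun {φ ψ} η => ?_⟩
    obtain ⟨g, hg, hact⟩ := BTemp.exists_conj_of_natTrans hG₂ φ.hom ψ.hom η.hom
    refine ⟨⟨g, hg⟩, ?_⟩
    apply ObjectProperty.hom_ext
    apply NatTrans.ext
    funext X
    apply ObjectProperty.hom_ext
    apply Action.Hom.ext
    refine ConcreteCategory.hom_ext _ _ fun x => ?_
    rw [hmap]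
    exact (hact X x).symm
  -- faithful: an element acting trivially on every `Π₂/N` is trivial
  haveI : E.Faithful := by
    refine ⟨fun {φ ψ} f f' hff' => ?_⟩
    have key : ∀ (X : BTemp G₂) (x : X.obj.V), X.obj.ρ f.elt x = X.obj.ρ f'.elt x := by
      intro X x
      rw [← hmap f X x, ← hmap f' X x, hff']
    have hmem : ∀ N : OpenNormalSubgroup G₂, f.elt⁻¹ * f'.elt ∈ N := by
      intro N
      have hq := key (BTemp.Q hG₂ N) ((1 : G₂) : G₂ ⧸ N.toSubgroup)
      rw [BTemp.Q_ρ_apply, BTemp.Q_ρ_apply, mul_one, mul_one] at hq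
      have hq' : ((f.elt : G₂) : G₂ ⧸ N.toSubgroup) = ((f'.elt : G₂) : G₂ ⧸ N.toSubgroup) := hq
      rw [QuotientGroup.eq] at hq'
      exact hq'
    have h1 := BTemp.eq_one_of_forall_mem_openNormal hG₂ _ hmem
    apply ContHomCat.Hom.ext
    rw [← mul_one f.elt, ← h1, mul_inv_cancel_left]
  -- essentially surjective: the hypothesis `TemperoidHomEqRes`
  haveI : E.EssSurj := ⟨fun F => by
    obtain ⟨φ, ⟨e⟩⟩ := h hG₁ hG₂ ⟨F.obj, F.property.1, F.property.2⟩
    exact ⟨⟨φ⟩, ⟨(ObjectProperty.isoMk _ e).symm⟩⟩⟩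
  haveI : E.IsEquivalence := {}
  exact ⟨E.asEquivalence.symm⟩

end Literature.AnabelianGeometry.SemiGraphs

end
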